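import Summits.QuantumFields.YangMills.Theorems.AlphaInputsT3ACv3AbelianRegion
import Summits.QuantumFields.YangMills.Theorems.AlphaInputsT3ACv3SymAvgBlockSum69
import Summits.QuantumFields.YangMills.Theorems.AlphaInputsT3ACv3ProfileLargeE
import HarnessLib

/-!
# `AlphaInputsT3ACv3ProfileRegionEML` — STRATEGY B for 2′χ, (U2) PART 1: **THE `j`-FOLD SYMMETRIC (0.4)∕`exp[mean log]` AVERAGE OF THE ENLARGED-REGION PROFILE IS ABELIAN AT
# A RECORDED PLAQUETTE** — `(blockAvg ℰp)^j (profE) = gexpAt (linAvgIter j potTE)` on the four bonds of `∂p′`, `p′ ∈ P_j(h)`, hence `Ū^{(j)}(profE)(∂p′) = gexp (curl (linAvgIter j potTE)(p′))`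
# — ★alpha-2 g4's regional EML engine run on the nested ancestor family of the corner set of `p′` — cell `ym3-torus`, width seat `ym-ust-19936-w4` (g5)

WHY (cell bus 2026-08-28: LEAD ★w1-19936 g3 card v1.2∕v1.3 §residue (E2)→(U2); ★★OWNER RULING g26-№8 (1)(α) «ONE currency in the class: `large67RecSet`»; ★w5-19936 g4
⧗p623726 `…v3ChargedGlueXs` §5 displays `hU2 : ∀ k ≤ K, ∀ h adm, ∀ X ∈ 𝔰𝔲(2), X ≠ 0 → profE … ∈ large67RecSet …`).  The recording currency reads the torus-side SYMMETRIC
average of [Balaban1987RG1] (0.4); the profile `profE = gexpAt potTE` (rfl, `profE_eq_gexpAt`) is abelian, and ✓ `AbelianEML.iter_blockAvg_gexpAt_region` (`…v3AbelianRegion`)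
makes its iterated averages abelian at the bonds under a nested region family from a REGIONAL fine-curl bound — the global bound of ✓ `iter_blockAvg_gexpAt` is useless here (the
profile's other scales have amplitudes `amp_i ≫ amp_j`).  THIS FILE supplies the region and the bound: §1 the torus curl of `potTE` is the `ℤ³` curl of `potZE` at any integer
representative (`curlAt_potTE_projSite`) and nested block ancestors (`proj_blockOf_eq`); §2 under the four corner blocks `B^j(·)` of `p′` every fine site is the projection of a point of
`Δ′(p′)` (`Site.fibreEquiv` + the index dictionary ✓ `projSite_nsmul_zOf_add_boxVec`∕`projSite_add_natCast_smul_e` + ✓ `fibreSite_runSite`), so ✓ `abs_curl_potZE_le_on_deltaBox` bounds the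
fine curls by `amp_j` in EVERY pair of directions (`abs_curlAt_potTE_le_of_proj`); §3 the engine on `R i := {z | B^{j−i}(z) ∈ corners(p′)}` under the window `(d+2)²·C68·g_ip(g_i) ≤ δ_N`
(which gives the level thresholds `(π∕2)((d+2)L)²∕4·(L²)^s·amp_j·‖X‖ < min(δ_N, ln 2)`, `s < j`): ★ `iter_blockAvg_profE_eq_at_corners`, ★★ `plaqHol_iter_blockAvg_profE_eq`.  The sibling
`…v3ProfileLargeRec` evaluates the curl (pattern tent sum) and concludes (U2).
HONEST FRAMING.  Kernel identities for a CONSTRUCTED test configuration; nothing of [B10]∕[7]∕[4]'s estimates asserted; def-free; count-neutral helper toward R3 2′χ (`HistoryTailL`,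
item 19936 — NOT proved here); registry untouched (J r4).  YM₃ on T³ is rung R3 of the programme (finite-torus SU(2)), not T⁴, not the continuum, not the Clay problem; no gap claimed.

References: T. Bałaban, Commun. Math. Phys. 109 (1987) 249–301 [Balaban1987RG1] ((0.4), (0.11) p.253); CMP 102 (1985) 255–275 [Balaban1985UV3] ((69)–(70) p.273); CMP 98
(1985) 17–51 [Balaban1985Averaging] ((9) p.19); CMP 85 (1982) 603–626 [Balaban1982Higgs1] ((2.12) p.609).
-/

set_option autoImplicit false

noncomputable section

open scoped BigOperators Matrix.Norms.L2Operator

namespace Summit.QuantumFields.YangMills.Theorems.ProfileEnlarged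

open Finset NormedSpace
open Literature.MathematicalPhysics.QuantumFieldTheory.Balaban1983to89
open Literature.MathematicalPhysics.QuantumFieldTheory.Balaban1983to89.T4Continuum
open Literature.MathematicalPhysics.QuantumFieldTheory.Balaban1983to89.BlockAveraging (blockAvg)
open Literature.MathematicalPhysics.QuantumFieldTheory.Balaban1983to89.LatticeFieldCalculus (runSite runSite_zero runSite_succ)
open Literature.MathematicalPhysics.QuantumFieldTheory.Balaban1983to89.ExpMeanLog (expMeanLogSU deltaSU deltaSU_pos)
open Literature.MathematicalPhysics.QuantumFieldTheory.Balaban1983to89.B10 (pFun)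
open Literature.MathematicalPhysics.QuantumFieldTheory.Balaban1985CMP102
open Literature.MathematicalPhysics.QuantumFieldTheory.Balaban1985CMP102.Setting
open Summit.QuantumFields.Balaban3D.Carriers
open Summit.QuantumFields.Balaban3D.Proofs.Primitives (AlphaConsts)
open Summit.QuantumFields.Balaban3D.Proofs.TorusLift (projSite zOf projSite_add_e zOf_apply)
open Summit.QuantumFields.Balaban3D.Proofs.GroupModelSkew (conjTranspose_eq_neg_of_mem_lie)
open Summit.QuantumFields.YangMills.Theorems.BalabanUVNodesN08AlphaAbelianLift (gexp gexp_add gexp_inv)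
open Summit.QuantumFields.YangMills.Theorems.BalabanUVNodesN08AlphaAbelianAverage (curl)
open Summit.QuantumFields.YangMills.Theorems.BalabanUVNodesN08AlphaProfileBuild (aj aj_pos amp amp_nonneg labZ)
open Summit.QuantumFields.YangMills.Theorems.BalabanUVNodesN08AlphaProfileLarge (mem_deltaBox_of_bounds)
open Summit.QuantumFields.YangMills.Theorems.BalabanUVNodesN08AlphaLiftAvgCont (sitesPerDir_zero_eq)
open Summit.QuantumFields.YangMills.Theorems.AbelianEML (gexpAt curlAt linAvgIter plaqHol_gexpAt iter_blockAvg_gexpAt_region)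
open Summit.QuantumFields.YangMills.Theorems.Prop7FlatCoercivity (fibreSite_runSite)
open Summit.QuantumFields.YangMills.Theorems.SymAvgBlockSum69 (projSite_add_natCast_smul_e projSite_nsmul_zOf_add_boxVec)
open B7Prop1Explicit (e e_apply boxVec)
open B10Eq70Squaring (deltaBox)

variable {L : ℕ} (S : Scales L)

/-! ## §1 Torus letters: the profile is `gexpAt potTE`; its fine curls are those of `potZE`; nested block ancestors -/

section Letters

variable {G : Type} [GaugeGroup G] [MeasurableSpace G] {𝔊 : GroupModel G} (𝔠 : AlphaConsts L 𝔊.N)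
  (X : Matrix (Fin 𝔊.N) (Fin 𝔊.N) ℂ) {k : ℕ} (h : Hist S.P k)

/-- **THE TORUS CURL OF `potTE` IS THE `ℤ³` CURL OF `potZE`** at any integer representative (`k ≤ m + K`: periodicity `potZE_labZ_projSite`). [folklore] -/
theorem curlAt_potTE_projSite (hk : k ≤ S.P.m + S.P.K) (y : B7Prop1Explicit.Site S.P.d) (μ ν : Fin S.P.d) :
    curlAt (potTE S 𝔠 X h) (projSite y) μ ν = curl (potZE S 𝔠 X h) y μ ν := by
  simp only [curlAt, curl, ← projSite_add_e, potTE, potZE_labZ_projSite S 𝔠 X h hk]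

variable {X} (hX : X ∈ 𝔊.lie)

/-- `profE = gexpAt potTE` (NODE O's `gexpCfg` is `gexpAt` at level `0`). [folklore] -/
theorem profE_eq_gexpAt : profE S 𝔠 h hX = gexpAt 𝔊 hX (potTE S 𝔠 X h) := rfl

end Letters

section Blocks

variable {P : Params}

/-- **NESTED BLOCK ANCESTORS**: the `(j−i)`-fold ancestor of a level-`i` site is the `(j−i−1)`-fold ancestor of its block (`i < j ≤ m + K`; the site counts
`|T^{(i)}| = L^{j−i}·|T^{(j)}|` are the tree's `N07CubeDomainsAdm22.sitesPerDir_eq_pow_mul`, re-derived inline to keep this import cone small). [cite: Balaban1982Higgs1, (2.12) p.609] -/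
theorem proj_blockOf_eq {i j : ℕ} (hij : i < j) (hjm : j ≤ P.m + P.K) (z : Site P i) :
    Site.proj j (j - (i + 1)) (blockOf z) = Site.proj j (j - i) z := by
  have hsd : ∀ {i' j' : ℕ}, i' ≤ j' → j' ≤ P.m + P.K → P.sitesPerDir i' = P.L ^ (j' - i') * P.sitesPerDir j' := by
    intro i' j' hij' hjm'
    unfold Params.sitesPerDir
    rw [mul_left_comm, ← pow_add]
    congr 2
    omega
  have h1 := hsd (Nat.le_succ i) (show i + 1 ≤ P.m + P.K by omega)
  rw [show i + 1 - i = 1 by omega] at h1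
  rw [← Site.proj_one_eq_blockOf, Site.proj_comp h1 (hsd hij hjm) z, show 1 + (j - (i + 1)) = j - i by omega]

end Blocks

/-! ## §2 The fine curls of `potTE` under the corner blocks of a recorded plaquette, and the EML identity at `∂p′` -/

section Region

variable {G : Type} [GaugeGroup G] [MeasurableSpace G] {𝔊 : GroupModel G} (𝔠 : AlphaConsts L 𝔊.N)
  (X : Matrix (Fin 𝔊.N) (Fin 𝔊.N) ℂ) {k : ℕ} (h : Hist S.P k)

/-- **UNDER THE FOUR CORNER BLOCKS `B^j(x′), B^j(x′+e_μ), B^j(x′+e_ν), B^j(x′+e_μ+e_ν)` OF A RECORDED PLAQUETTE THE FINE CURLS OF `potTE` ARE `≤ amp_j`** in every pair of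
directions: such a fine site is the projection of a point of `Δ′(p′)` (`fibreEquiv` + the index dictionary of `…SymAvgBlockSum69`), where ✓ `abs_curl_potZE_le_on_deltaBox` applies.
[cite: Balaban1985UV3, (69)–(70) p.273] -/
theorem abs_curlAt_potTE_le_of_proj (hX0 : X ≠ 0) (hk : k ≤ S.K) (hR : CollarE S 𝔠 k)
    (hadm : Hist.Admissible 𝔠.lane.carrier.M₁ (rcolOf S 𝔠.lane.carrier) k h) {j : ℕ} (hj : j < k) {p : Plaq S.P j} (hp : p ∈ h ⟨j, hj⟩)
    {x : Site S.P 0} (hx : ∃ a b : ℕ, a ≤ 1 ∧ b ≤ 1 ∧ Site.proj j (j - 0) x = runSite (runSite p.src p.μ a) p.ν b) (μ ν : Fin S.P.d) :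
    |curlAt (potTE S 𝔠 X h) x μ ν| ≤ amp S 𝔠 X j := by
  classical
  have hkm : k ≤ S.P.m + S.P.K := le_trans hk (Nat.le_add_left _ _)
  have hjm : j ≤ S.P.m + S.P.K := by omega
  have h0j : S.P.sitesPerDir 0 = S.P.L ^ j * S.P.sitesPerDir j := sitesPerDir_zero_eq hjm
  obtain ⟨a, b, ha, hb, hc⟩ := hx
  rw [Nat.sub_zero] at hc
  set c : Site S.P j := runSite (runSite p.src p.μ a) p.ν b with hcdef
  -- the offset of `x` in the block `B^j(c)`
  set r : Fin S.P.d → Fin (S.P.L ^ j) := Site.fibreEquiv (i := 0) h0j c ⟨x, hc⟩ with hr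
  have hxr : Site.fibreSite 0 j c r = x :=
    congrArg Subtype.val ((Site.fibreEquiv (i := 0) h0j c).symm_apply_apply ⟨x, hc⟩)
  -- the integer representative in `Δ′(p′)`
  set y : B7Prop1Explicit.Site S.P.d := (S.P.L ^ j : ℕ) • zOf p + boxVec (S.P.L ^ j) r +
    (((a * S.P.L ^ j : ℕ)) : ℤ) • e p.μ + (((b * S.P.L ^ j : ℕ)) : ℤ) • e p.ν with hy
  have hyx : projSite (P := S.P) y = x := by
    rw [hy, projSite_add_natCast_smul_e, projSite_add_natCast_smul_e, projSite_nsmul_zOf_add_boxVec,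
      ← fibreSite_runSite h0j, ← fibreSite_runSite h0j]
    exact hxr
  have hμν : p.μ ≠ p.ν := ne_of_lt p.hμν
  have hyΔ : y ∈ deltaBox (S.P.L ^ j) ((S.P.L ^ j : ℕ) • zOf p) p.μ p.ν := by
    refine mem_deltaBox_of_bounds S p fun i => ?_
    have hri : ((r i : ℕ) : ℤ) < (S.P.L : ℤ) ^ j := by exact_mod_cast (r i).isLt
    have hr0 : (0 : ℤ) ≤ ((r i : ℕ) : ℤ) := by exact_mod_cast Nat.zero_le _
    have hLj : (0 : ℤ) ≤ (S.P.L : ℤ) ^ j := by positivity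
    have ha' : ((a * S.P.L ^ j : ℕ) : ℤ) ≤ (S.P.L : ℤ) ^ j := by
      have : a * S.P.L ^ j ≤ 1 * S.P.L ^ j := Nat.mul_le_mul_right _ ha
      rw [one_mul] at this; exact_mod_cast this
    have hb' : ((b * S.P.L ^ j : ℕ) : ℤ) ≤ (S.P.L : ℤ) ^ j := by
      have : b * S.P.L ^ j ≤ 1 * S.P.L ^ j := Nat.mul_le_mul_right _ hb
      rw [one_mul] at this; exact_mod_cast this
    have ha0 : (0 : ℤ) ≤ ((a * S.P.L ^ j : ℕ) : ℤ) := by exact_mod_cast Nat.zero_le _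
    have hb0 : (0 : ℤ) ≤ ((b * S.P.L ^ j : ℕ) : ℤ) := by exact_mod_cast Nat.zero_le _
    have hyi : y i = (S.P.L : ℤ) ^ j * zOf p i + ((r i : ℕ) : ℤ) +
        (((a * S.P.L ^ j : ℕ) : ℤ) * (if i = p.μ then 1 else 0) + ((b * S.P.L ^ j : ℕ) : ℤ) * (if i = p.ν then 1 else 0)) := by
      simp only [hy, Pi.add_apply, Pi.smul_apply, Pi.mul_apply, Pi.natCast_apply, boxVec, e_apply, smul_eq_mul, nsmul_eq_mul]
      push_cast
      ring
    rw [hyi]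
    by_cases hiμ : i = p.μ
    · rw [if_pos hiμ, if_neg (fun hiν => hμν (hiμ.symm.trans hiν)), if_pos (Or.inl hiμ)]
      constructor <;> nlinarith
    · by_cases hiν : i = p.ν
      · rw [if_neg hiμ, if_pos hiν, if_pos (Or.inr hiν)]
        constructor <;> nlinarith
      · rw [if_neg hiμ, if_neg hiν, if_neg (not_or.mpr ⟨hiμ, hiν⟩)]
        constructor <;> nlinarith
  rw [← hyx, curlAt_potTE_projSite S 𝔠 X h hkm]
  exact abs_curl_potZE_le_on_deltaBox S 𝔠 X h hX0 hk hR hadm hj hp hyΔ μ ν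

end Region

section SUN

variable {N : ℕ} [NeZero N] (𝔠 : AlphaConsts L (suGroupModel N).N) {X : Matrix (Fin (suGroupModel N).N) (Fin (suGroupModel N).N) ℂ}
  (hX : X ∈ (suGroupModel N).lie) {k : ℕ} (h : Hist S.P k)

/-- **★ THE `j`-FOLD SYMMETRIC AVERAGE OF THE PROFILE IS ABELIAN AT THE FOUR BONDS OF A RECORDED PLAQUETTE**: under the collars (N2′) and the window `(d+2)²·C68·g_ip(g_i) ≤ δ_N`
(`i < k`), for `p′ ∈ P_j(h)` and every level-`j` bond `c` with both endpoints among the corners of `p′`: `(blockAvg ℰp)^j (profE) c = gexpAt (linAvgIter j potTE) c` — ★alpha-2's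
regional engine on the ancestor family of the corner set. [cite: Balaban1987RG1, (0.4)+(0.11) p.253; Balaban1985UV3, (69)–(70) p.273] -/
theorem iter_blockAvg_profE_eq_at_corners (hX0 : X ≠ 0) (hk : k ≤ S.K) (hR : CollarE S 𝔠 k)
    (hwin : ∀ i, i < k → ((S.P.d : ℝ) + 2) ^ 2 * (𝔠.C68 * aj S 𝔠 i) ≤ deltaSU (Fin N))
    (hadm : Hist.Admissible 𝔠.lane.carrier.M₁ (rcolOf S 𝔠.lane.carrier) k h) {j : ℕ} (hj : j < k) {p : Plaq S.P j} (hp : p ∈ h ⟨j, hj⟩)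
    (c : PBond S.P j) (hcs : ∃ a b : ℕ, a ≤ 1 ∧ b ≤ 1 ∧ c.src = runSite (runSite p.src p.μ a) p.ν b)
    (hct : ∃ a b : ℕ, a ≤ 1 ∧ b ≤ 1 ∧ c.tgt = runSite (runSite p.src p.μ a) p.ν b) :
    Averaging.iter (fun i => blockAvg (P := S.P) (j := i) (expMeanLogSU (n := Fin N))) j (profE S 𝔠 h hX) c =
      gexpAt (suGroupModel N) hX (linAvgIter j (potTE S 𝔠 X h)) c := by
  have hkm : k ≤ S.P.m + S.P.K := le_trans hk (Nat.le_add_left _ _)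
  have hjm : j ≤ S.P.m + S.P.K := by omega
  -- the nested family of ancestor sets of the corner set
  let R : (i : ℕ) → Set (Site S.P i) := fun i =>
    {z | ∃ a b : ℕ, a ≤ 1 ∧ b ≤ 1 ∧ Site.proj j (j - i) z = runSite (runSite p.src p.μ a) p.ν b}
  have hRnest : ∀ i, i < j → ∀ z : Site S.P i, z ∈ R i ↔ blockOf z ∈ R (i + 1) := by
    intro i hi z
    simp only [R, Set.mem_setOf_eq, proj_blockOf_eq hi hjm]
  -- fine curls under `R 0`
  have hB : ∀ (x : Site S.P 0) (μ ν : Fin S.P.d), μ ≠ ν → x ∈ R 0 → x.shift μ ∈ R 0 → x.shift ν ∈ R 0 → (x.shift μ).shift ν ∈ R 0 →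
      |curlAt (potTE S 𝔠 X h) x μ ν| ≤ amp S 𝔠 X j :=
    fun x μ ν _ hx _ _ _ => abs_curlAt_potTE_le_of_proj S 𝔠 X h hX0 hk hR hadm hj hp hx μ ν
  -- the level thresholds from the window
  have hL1 : (1 : ℝ) ≤ S.P.L := by exact_mod_cast le_of_lt S.hL.2
  have hL0 : (0 : ℝ) < S.P.L := by linarith
  have hXn : 0 < ‖X‖ := norm_pos_iff.2 hX0
  have hδ : 0 < deltaSU (Fin N) := deltaSU_pos
  have hδ3 : deltaSU (Fin N) ≤ 1 / 3 := min_le_left _ _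
  have hlog2 : (1 : ℝ) / 3 < Real.log 2 := by have := Real.log_two_gt_d9; linarith
  have hthr : ∀ s, s < j → Real.pi / 2 * (((((S.P.d + 2) * S.P.L : ℕ) : ℝ) ^ 2 / 4) * (((S.P.L : ℝ) ^ 2) ^ s * amp S 𝔠 X j)) * ‖X‖ <
      min (deltaSU (Fin N)) (Real.log 2) := by
    intro s hs
    have hw := hwin j (by omega)
    have haj : 0 < aj S 𝔠 j := aj_pos S 𝔠 (by omega)
    have hCa : 0 ≤ 𝔠.C68 * aj S 𝔠 j := mul_nonneg 𝔠.C68_pos.le haj.le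
    -- `amp_j ‖X‖ (L^j)² = C68 a_j / 4`
    have hLpos : (0 : ℝ) < (L : ℝ) ^ j := pow_pos (by exact_mod_cast lt_trans zero_lt_one S.hL.2) j
    have hXne : ‖X‖ ≠ 0 := hXn.ne'
    have hampL : amp S 𝔠 X j * ((L : ℝ) ^ j) ^ 2 * ‖X‖ = 𝔠.C68 * aj S 𝔠 j / 4 := by
      unfold amp; field_simp
    have hPL : (S.P.L : ℝ) = L := by norm_cast
    -- `(L²)^s ≤ (L²)^(j-1)` and `((d+2)L)² (L²)^s amp ‖X‖ ≤ (d+2)² C68 a_j / 4`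
    have hpow : ((S.P.L : ℝ) ^ 2) ^ s * (S.P.L : ℝ) ^ 2 ≤ ((S.P.L : ℝ) ^ j) ^ 2 := by
      rw [← pow_succ, ← pow_mul, ← pow_mul]
      exact pow_le_pow_right₀ hL1 (by omega)
    have hmain : ((((S.P.d + 2) * S.P.L : ℕ) : ℝ) ^ 2 / 4) * (((S.P.L : ℝ) ^ 2) ^ s * amp S 𝔠 X j) * ‖X‖ ≤
        ((S.P.d : ℝ) + 2) ^ 2 * (𝔠.C68 * aj S 𝔠 j) / 16 := by
      have hamp0 : 0 ≤ amp S 𝔠 X j := amp_nonneg S 𝔠 hX0 (by omega)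
      have e1 : ((((S.P.d + 2) * S.P.L : ℕ) : ℝ) ^ 2 / 4) * (((S.P.L : ℝ) ^ 2) ^ s * amp S 𝔠 X j) * ‖X‖ =
          ((S.P.d : ℝ) + 2) ^ 2 / 4 * ((((S.P.L : ℝ) ^ 2) ^ s * (S.P.L : ℝ) ^ 2) * (amp S 𝔠 X j * ‖X‖)) := by
        push_cast; ring
      have e2 : ((S.P.d : ℝ) + 2) ^ 2 * (𝔠.C68 * aj S 𝔠 j) / 16 =
          ((S.P.d : ℝ) + 2) ^ 2 / 4 * (((S.P.L : ℝ) ^ j) ^ 2 * (amp S 𝔠 X j * ‖X‖)) := by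
        rw [hPL, show ((L : ℝ) ^ j) ^ 2 * (amp S 𝔠 X j * ‖X‖) = amp S 𝔠 X j * ((L : ℝ) ^ j) ^ 2 * ‖X‖ by ring, hampL]
        ring
      rw [e1, e2]
      have hd0 : (0 : ℝ) ≤ ((S.P.d : ℝ) + 2) ^ 2 / 4 := by positivity
      exact mul_le_mul_of_nonneg_left (mul_le_mul_of_nonneg_right hpow (mul_nonneg hamp0 (norm_nonneg _))) hd0
    have hpi4 : Real.pi / 2 / 16 < 1 := by have := Real.pi_lt_four; linarith
    rw [lt_min_iff]
    have hkey : Real.pi / 2 * (((((S.P.d + 2) * S.P.L : ℕ) : ℝ) ^ 2 / 4) * (((S.P.L : ℝ) ^ 2) ^ s * amp S 𝔠 X j)) * ‖X‖ ≤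
        Real.pi / 2 / 16 * deltaSU (Fin N) := by
      have := mul_le_mul_of_nonneg_left (hmain.trans (div_le_div_of_nonneg_right hw (by norm_num))) (show (0 : ℝ) ≤ Real.pi / 2 by positivity)
      calc Real.pi / 2 * (((((S.P.d + 2) * S.P.L : ℕ) : ℝ) ^ 2 / 4) * (((S.P.L : ℝ) ^ 2) ^ s * amp S 𝔠 X j)) * ‖X‖
          = Real.pi / 2 * (((((S.P.d + 2) * S.P.L : ℕ) : ℝ) ^ 2 / 4) * (((S.P.L : ℝ) ^ 2) ^ s * amp S 𝔠 X j) * ‖X‖) := by ring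
        _ ≤ Real.pi / 2 * (deltaSU (Fin N) / 16) := this
        _ = Real.pi / 2 / 16 * deltaSU (Fin N) := by ring
    constructor
    · calc _ ≤ Real.pi / 2 / 16 * deltaSU (Fin N) := hkey
        _ < 1 * deltaSU (Fin N) := mul_lt_mul_of_pos_right hpi4 hδ
        _ = deltaSU (Fin N) := one_mul _
    · calc _ ≤ Real.pi / 2 / 16 * deltaSU (Fin N) := hkey
        _ < 1 * deltaSU (Fin N) := mul_lt_mul_of_pos_right hpi4 hδ
        _ = deltaSU (Fin N) := one_mul _
        _ < Real.log 2 := hδ3.trans_lt hlog2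
  have key := iter_blockAvg_gexpAt_region (P := S.P) hX hX0 j hjm R hRnest (potTE S 𝔠 X h) (amp_nonneg S 𝔠 hX0 (by omega)) hB hthr j le_rfl c
  rw [profE_eq_gexpAt]
  refine key ?_ ?_
  · simp only [R, Set.mem_setOf_eq, Nat.sub_self, Site.proj_zero]; exact hcs
  · simp only [R, Set.mem_setOf_eq, Nat.sub_self, Site.proj_zero]; exact hct

/-- **★ THE RECORDED PLAQUETTE OF THE `j`-FOLD SYMMETRIC AVERAGE OF THE PROFILE IS `gexp` OF THE CURL OF THE ITERATED LINEAR AVERAGE.** [cite: Balaban1987RG1, (0.4)+(0.11) p.253;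
Balaban1985Averaging, (9) p.19] -/
theorem plaqHol_iter_blockAvg_profE_eq (hX0 : X ≠ 0) (hk : k ≤ S.K) (hR : CollarE S 𝔠 k)
    (hwin : ∀ i, i < k → ((S.P.d : ℝ) + 2) ^ 2 * (𝔠.C68 * aj S 𝔠 i) ≤ deltaSU (Fin N))
    (hadm : Hist.Admissible 𝔠.lane.carrier.M₁ (rcolOf S 𝔠.lane.carrier) k h) {j : ℕ} (hj : j < k) {p : Plaq S.P j} (hp : p ∈ h ⟨j, hj⟩) :
    GaugeField.plaqHol (Averaging.iter (fun i => blockAvg (P := S.P) (j := i) (expMeanLogSU (n := Fin N))) j (profE S 𝔠 h hX)) p =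
      gexp (suGroupModel N) hX (curlAt (linAvgIter j (potTE S 𝔠 X h)) p.src p.μ p.ν) := by
  have h1 : ∀ x : Site S.P j, ∀ a b : ℕ, a ≤ 1 → b ≤ 1 → x = runSite (runSite p.src p.μ a) p.ν b →
      ∃ a b : ℕ, a ≤ 1 ∧ b ≤ 1 ∧ x = runSite (runSite p.src p.μ a) p.ν b := fun x a b ha hb hx => ⟨a, b, ha, hb, hx⟩
  have e00 : p.src = runSite (runSite p.src p.μ 0) p.ν 0 := by rw [runSite_zero, runSite_zero]
  have e10 : p.src.shift p.μ = runSite (runSite p.src p.μ 1) p.ν 0 := by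
    rw [runSite_zero, show (1 : ℕ) = 0 + 1 from rfl, runSite_succ, runSite_zero]
  have e01 : p.src.shift p.ν = runSite (runSite p.src p.μ 0) p.ν 1 := by
    rw [runSite_zero, show (1 : ℕ) = 0 + 1 from rfl, runSite_succ, runSite_zero]
  have e11 : (p.src.shift p.μ).shift p.ν = runSite (runSite p.src p.μ 1) p.ν 1 := by
    rw [show (1 : ℕ) = 0 + 1 from rfl, runSite_succ, runSite_zero, runSite_succ, runSite_zero]
  have e11' : (p.src.shift p.ν).shift p.μ = runSite (runSite p.src p.μ 1) p.ν 1 := by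
    rw [← BlockAveragingEMLProp2.shift_shift_comm p.src p.μ p.ν]; exact e11
  have key := fun c hcs hct => iter_blockAvg_profE_eq_at_corners S 𝔠 hX h hX0 hk hR hwin hadm hj hp c hcs hct
  have hplaq : GaugeField.plaqHol (Averaging.iter (fun i => blockAvg (P := S.P) (j := i) (expMeanLogSU (n := Fin N))) j (profE S 𝔠 h hX)) p =
      GaugeField.plaqHol (gexpAt (suGroupModel N) hX (linAvgIter j (potTE S 𝔠 X h))) p := by
    simp only [GaugeField.plaqHol]
    rw [key ⟨p.src, p.μ⟩ (h1 _ 0 0 zero_le_one zero_le_one e00) (h1 _ 1 0 le_rfl zero_le_one e10),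
      key ⟨p.src.shift p.μ, p.ν⟩ (h1 _ 1 0 le_rfl zero_le_one e10) (h1 _ 1 1 le_rfl le_rfl e11),
      key ⟨p.src.shift p.ν, p.μ⟩ (h1 _ 0 1 zero_le_one le_rfl e01) (h1 _ 1 1 le_rfl le_rfl e11'),
      key ⟨p.src, p.ν⟩ (h1 _ 0 0 zero_le_one zero_le_one e00) (h1 _ 0 1 zero_le_one le_rfl e01)]
  rw [hplaq, plaqHol_gexpAt]
  rfl

end SUN

end Summit.QuantumFields.YangMills.Theorems.ProfileEnlarged

end
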